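/-
Copyright: the b2b-balaban T⁴-continuum CRUX team, row NE7b leaf lineage `t4-ne7b-formalise-leaf-03` (gen 151). Project licence.
-/
import Summits.QuantumFields.BalabanUV.T4Continuum.Spine.NE7b.OneShotChartPairBound

/-!
# THE ONE-SHOT CHART LETTER, UNIFORMLY IN THE BLOCK SIDE: `g_N ≥ 3∕5` for EVERY `N ≥ 1`, hence `S₂∕S² ≤ (5∕3)^d` and
# `‖H_M‖²_η ≤ (5∕3)^d` for EVERY side `M` (d = 4: `7.72`; the tree's `(π²∕4)^d = 37.1` (42) ∕ `0.58^{−d} = 8.84` for `M ≥ 3` (45))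
# (row NE7b, node U5c; [folklore] two aliases + `sin t ≥ t − t³∕6`, `cos t ≥ 1 − t²∕2`, exact rational arithmetic on eight pieces; the OWNER's
# (40) `Sxir_shift_ge`, (43) `sum_normSq_G_le_div_Xr` ∕ `tsum_HBZd_sq_le_of_fibre`, (45) `Xr_ge_prod_letter` ∕ `letter_term_nonneg` BY NAME)

Cell `pub-balaban`, sub-cell `t4`, spine estimate NE7b (`T4WeightBudget.RelWeightBound`; the cell's OWN estimate — NOT PRINTED in
[Bałaban 1983–89], NOT PROVED).  Crux-route work under `Spine/NE7b/` by leaf-03 (CRUX team (2), FREEZE (0) crux-prover clause; FILING-CLAIM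
C-leaf03-g151-LOWLEVELS, the OWNER's RULING W-ne7bp1-g112-2: «OSFU GO — not subsumed; cite (43)∕(44)∕(45) by name; OSFL folded»).  NOTHING
of Bałaban's is asserted, valued or discharged: `uFactorr`, `Sxir`, `S1r` (`B4Strip`), `Xr`, `symbR` (`B6QGQFourier275Zd`), `G` (`B4StripSums`),
`HBZd` (`B5Hk165L2Zd`) are the tree's [folklore] Fourier bookkeeping of the scalar free field and its block-averaging section; no
`T4Continuum/Support` leaf; no `def` (the alias sum `g_N(x) = Σ_{j<N} uFactorr(N,j,x)·ρ_j(x)`, `ρ_0 = 1`, `ρ_j = S_ξ(x)∕S_ξ(x+2πj)`, is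
written out in (45)'s letters); zero `sorry`.

THE IDEA.  (45) factorises the all-alias fibre sum, `X(p) ≥ Π_μ g_N(p_μ)`, and bounds `g_N ≥ 0.58` (`N ≥ 3`) by a near-central PAIR.  Here
the pair is estimated for every `N`: for `N ≥ 3` the central alias and the one at `x ∓ 2π` (`S_ξ = 4N²sin²((2π−|x|)∕2N) ≤ (2π−|x|)²`), with
`S_ξ(x) ≤ x²` and `2N sin(|x|∕2N) ≥ |x| − |x|³∕216`, give `g_N(x) ≥ m(|x|)`, `m(t) = 4 sin²(t∕2)·(1∕t² + (t − t³∕216)²∕(2π − t)⁴)` (`min m =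
0.677`; `inf_N min g_N = 0.693`); `m ≥ 3∕5` on `(0, π]`: on `(0, 2.3]` by `sin(t∕2) ≥ t∕2 − t³∕48` and the first term, on `[2.3, π]` by
`sin(t∕2) ≥ 1 − (3.15 − t)²∕8`, `2π − t ≤ 6.3 − t` and monotonicity on seven sub-intervals, each closed by `norm_num` on rationals (margins
≥ 4 %).  `N = 2`: `g_2 = (1+c)∕2 + (1−c)²∕(2(1+c)) ≥ 4∕5`, `c = cos(x∕2)` (the sharp `2√2 − 2` is (44) `pair_ge`); `N = 1`: `g_1 = 1`.

WHAT IS PROVED ([folklore]; `p ∈ BZ d = [−π,π]^d`, `a > 0`):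
* §0 `pow_le_Xr_of_aliasSum_ge` (`g_N ≥ c ≥ 0` ⟹ `c^d ≤ X(p)`, from (45)), **`sum_normSq_G_le_of_aliasSum_ge`** (`g_N ≥ c > 0` ⟹
  `Σ_τ ‖G_{N,a,0,τ}(p)‖² ≤ N^d (c⁻¹)^d symbR(p)²`, from (43)).
* §1 `shiftedSymbol_eq`, `Sxir_ge_sub_cube`, **`twoAlias_le_aliasSum`** (`m(|x|) ≤ g_N(x)`, `N ≥ 3`, `0 < |x| ≤ π`).
* §2 `piece`, **`minorant_ge`** (`3∕5 ≤ m(t)`, `0 < t ≤ π`); `letters_two`, **`aliasSum_two_ge`** (`g_2 ≥ 4∕5`).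
* §3 **`aliasSum_ge_three_fifths`** (`3∕5 ≤ g_N(x)`, EVERY `N ≥ 1`, `|x| ≤ π`); **`sum_normSq_G_le_uniform`**:
  `Σ_τ ‖G_{N,a,0,τ}(p)‖² ≤ N^d (5∕3)^d symbR(p)²`, every `N ≥ 1` — (40)'s `sum_normSq_G_le` with `(π²∕4)^d ↦ (5∕3)^d`.
* §4 through (43)'s `K`-socket: **`tsum_HBZd_sq_le_uniform_eta`** (`((n+1)^d)⁻¹Σ′_z(HB)(z)² ≤ (5∕3)^d Σ′_yB(y)²`, EVERY `n`, every
  square-summable `B` — `B5HkUniformL2Zd.tsum_HBZd_sq_le_uniform` ∕ (42) `…_uniform_sharp` ∕ (45) `…_threeUp` with ONE constant, no restriction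
  on `n`), **`compositeBlocking_chart_sharp`** ((35)'s chart clause for finset-supported `B`, `C := (5∕3)^d` explicit), `five_thirds_pow_four_lt`
  (d = 4: `(5∕3)⁴ < 7.72 < 3²`, `‖H_M‖_η < 2.78` every `M`; threshold `M^{(d−2)∕2} = M` met from `M = 3`, at `M = 2` by (44)).

NOT HERE (honest): the Plancherel passage itself ((41)–(43), by name); the sharp constants (`1.184 ∕ 1.434 ∕ 1.76` at d = 4, desk instrument
no. 5); anything of Bałaban's ((A3), NC-NE7b-α UNRULED).  BY-NAME EFFECT ON THE WALL: NONE.  NE7b NOT PRINTED ∕ NOT PROVED; spine PROVED 0∕9;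
rung (B)+1 on a FINITE torus — NOT infinite volume, NOT the mass gap, NOT Clay.  HONEST DEPENDENCY: continuum YM on T⁴ ⇐ BetaPertH ∧ nine spine
estimates (0∕9 proved); BetaPertH ⇐ (D1) ∧ (D4) ∧ CAP+tail.
-/

set_option autoImplicit false

namespace Summit.QuantumFields.BalabanUV.T4Continuum.NE7b.OneShotChartFibreUniform

open Finset Real
open Literature.MathematicalPhysics.QuantumFieldTheory.Balaban1983to89
open B4Strip (ofRealVec uFactorr Sxir S1r Sxir_eq Sxir_le S1r_eq Sxir_nonneg Sxir_pos uFactorr_nonneg)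
open B4StripSums (G)
open B4ContourShift (BZ)
open B6QGQLower276 (X B)
open B6QGQFourier275Zd (symbR Xr Xr_ge)
open B5Hk165L2Zd (HBZd)
open OneShotChartFibreChain (sum_normSq_G_le_div_Xr tsum_HBZd_sq_le_of_fibre)
open OneShotChartPairBound (Xr_ge_prod_letter letter_term_nonneg)

noncomputable section

variable {d : ℕ}

/-! ## §0. From a one-dimensional bound to the fibre letter, through (45) and (43) -/

/-- A uniform one-dimensional bound gives a product bound: `g_N ≥ c ≥ 0` on `[−π,π]` ⟹ `c^d ≤ X(p)` on the zone ((45) `Xr_ge_prod_letter`: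
`Π_μ g_N(p_μ) ≤ X(p)`). [folklore] -/
theorem pow_le_Xr_of_aliasSum_ge (N : ℕ) [NeZero N] {c : ℝ} (hc : 0 ≤ c)
    (hg : ∀ x : ℝ, |x| ≤ π → c ≤ ∑ j : Fin N, uFactorr N j x *
      (if (j : ℕ) = 0 then (1 : ℝ) else Sxir N x / Sxir N (x + 2 * π * (j : ℕ))))
    (p : Fin d → ℝ) (hp : p ∈ BZ d) : c ^ d ≤ Xr N p := by
  refine le_trans ?_ (Xr_ge_prod_letter N p hp)
  rw [show c ^ d = ∏ _μ : Fin d, c by rw [Finset.prod_const, Finset.card_univ, Fintype.card_fin]]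
  exact Finset.prod_le_prod (fun _ _ => hc) fun μ _ => hg (p μ) (abs_le.mpr ⟨hp.1 μ, hp.2 μ⟩)

/-- **THE GENERIC CONSEQUENCE FOR THE (2.48) MULTIPLIERS**: if `g_N ≥ c > 0` on `[−π,π]`, then
`Σ_τ ‖G_{N,a,0,τ}(p)‖² ≤ N^d · (c⁻¹)^d · symbR(p)²` on the zone — (43) `sum_normSq_G_le_div_Xr` (`≤ N^d symbR²∕X`) and `X ≥ c^d`. [folklore] -/
theorem sum_normSq_G_le_of_aliasSum_ge (N : ℕ) [NeZero N] (hN : 1 ≤ N) {a : ℝ} (ha : 0 < a) {c : ℝ} (hc : 0 < c)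
    (hg : ∀ x : ℝ, |x| ≤ π → c ≤ ∑ j : Fin N, uFactorr N j x *
      (if (j : ℕ) = 0 then (1 : ℝ) else Sxir N x / Sxir N (x + 2 * π * (j : ℕ))))
    (p : Fin d → ℝ) (hp : p ∈ BZ d) :
    ∑ τ : Fin d → Fin N, ‖G N a 0 τ (ofRealVec p)‖ ^ 2 ≤ (N : ℝ) ^ d * (c⁻¹) ^ d * symbR N a p ^ 2 := by
  have hX := pow_le_Xr_of_aliasSum_ge N hc.le hg p hp
  calc ∑ τ : Fin d → Fin N, ‖G N a 0 τ (ofRealVec p)‖ ^ 2 ≤ (N : ℝ) ^ d * (symbR N a p ^ 2 / Xr N p) :=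
        sum_normSq_G_le_div_Xr N hN ha p hp
    _ ≤ (N : ℝ) ^ d * (symbR N a p ^ 2 / c ^ d) :=
        mul_le_mul_of_nonneg_left (div_le_div_of_nonneg_left (sq_nonneg _) (by positivity) hX) (by positivity)
    _ = (N : ℝ) ^ d * (c⁻¹) ^ d * symbR N a p ^ 2 := by rw [div_eq_mul_inv, inv_pow]; ring

/-! ## §1. The two-alias minorant for `N ≥ 3` -/

/-- The `∓2π` alias: for `0 < |x| ≤ π` and `N ≥ 2` there is a non-central index `j⋆` (`N − 1` if `x > 0`, `1` if `x < 0`) with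
`S_ξ(x + 2πj⋆) = 4N² sin²((2π − |x|)∕(2N))`. [folklore] -/
theorem shiftedSymbol_eq (N : ℕ) (hN : 2 ≤ N) (x : ℝ) (hx0 : x ≠ 0) :
    ∃ j : Fin N, (j : ℕ) ≠ 0 ∧ Sxir N (x + 2 * π * (j : ℕ)) = 4 * (N : ℝ) ^ 2 * Real.sin ((2 * π - |x|) / (2 * N)) ^ 2 := by
  have hN0 : (N : ℝ) ≠ 0 := by exact_mod_cast (show N ≠ 0 by omega)
  rcases lt_or_gt_of_ne hx0 with hneg | hpos
  · refine ⟨⟨1, by omega⟩, by simp, ?_⟩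
    rw [abs_of_neg hneg, Sxir_eq]
    congr 2; push_cast; ring_nf
  · refine ⟨⟨N - 1, by omega⟩, by simp; omega, ?_⟩
    rw [abs_of_pos hpos]
    have hcast : (((N - 1 : ℕ) : ℕ) : ℝ) = (N : ℝ) - 1 := by
      rw [Nat.cast_sub (by omega)]; simp
    unfold Sxir
    rw [show (x + 2 * π * (((⟨N - 1, by omega⟩ : Fin N) : ℕ) : ℝ)) / (N : ℝ) = (x - 2 * π) / N + 2 * π by
      rw [hcast]; field_simp; ring, Real.cos_add_two_pi]
    rw [show (x - 2 * π) / (N : ℝ) = 2 * ((x - 2 * π) / (2 * N)) by field_simp, Real.cos_two_mul,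
      Real.cos_sq ((x - 2 * π) / (2 * N))]
    rw [show (2 * π - x) / (2 * (N : ℝ)) = -((x - 2 * π) / (2 * N)) by ring, Real.sin_neg, neg_sq,
      Real.sin_sq ((x - 2 * π) / (2 * N)), Real.cos_sq ((x - 2 * π) / (2 * N))]
    ring

/-- `S_ξ(x) ≥ (|x| − |x|³∕216)²` for `N ≥ 3`, `|x| ≤ π` (`2N sin(t∕2N) ≥ t − t³∕(24N²)`, `Real.sin_ge_sub_cube`). [folklore] -/
theorem Sxir_ge_sub_cube (N : ℕ) (hN : 3 ≤ N) (x : ℝ) (hx : |x| ≤ π) :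
    (|x| - |x| ^ 3 / 216) ^ 2 ≤ Sxir N x := by
  have hN3 : (3 : ℝ) ≤ N := by exact_mod_cast hN
  have hN0 : (0 : ℝ) < N := by linarith
  set t : ℝ := |x| with ht
  have ht0 : 0 ≤ t := abs_nonneg x
  have htπ : t ≤ π := hx
  have hπ := Real.pi_lt_d2
  have heven : Sxir N x = 4 * (N : ℝ) ^ 2 * Real.sin (t / (2 * N)) ^ 2 := by
    rw [Sxir_eq]
    rcases abs_choice x with h | h
    · rw [ht, h]
    · rw [ht, h, neg_div, Real.sin_neg, neg_sq]
  rw [heven]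
  have hs : t / (2 * N) - (t / (2 * N)) ^ 3 / 6 ≤ Real.sin (t / (2 * N)) := Real.sin_ge_sub_cube (by positivity)
  have hlow : t - t ^ 3 / 216 ≤ 2 * N * (t / (2 * N) - (t / (2 * N)) ^ 3 / 6) := by
    rw [show 2 * (N : ℝ) * (t / (2 * N) - (t / (2 * N)) ^ 3 / 6) = t - t ^ 3 / (24 * (N : ℝ) ^ 2) by field_simp; ring]
    have h1 : t ^ 3 / 216 ≥ t ^ 3 / (24 * (N : ℝ) ^ 2) := by
      apply div_le_div_of_nonneg_left (by positivity) (by norm_num) (by nlinarith)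
    linarith
  have hnn : 0 ≤ t - t ^ 3 / 216 := by
    have : t ^ 3 ≤ 216 * t := by nlinarith [mul_nonneg ht0 ht0]
    linarith
  have h2 : t - t ^ 3 / 216 ≤ 2 * N * Real.sin (t / (2 * N)) := hlow.trans (by nlinarith)
  calc (t - t ^ 3 / 216) ^ 2 ≤ (2 * N * Real.sin (t / (2 * N))) ^ 2 := pow_le_pow_left₀ hnn h2 2
    _ = 4 * (N : ℝ) ^ 2 * Real.sin (t / (2 * N)) ^ 2 := by ring

/-- **The two-alias minorant**: for `N ≥ 3` and `0 < |x| ≤ π`,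
`4 sin²(|x|∕2)·(1∕|x|² + (|x| − |x|³∕216)²∕(2π − |x|)⁴) ≤ g_N(x)`. [folklore] -/
theorem twoAlias_le_aliasSum (N : ℕ) [NeZero N] (hN : 3 ≤ N) (x : ℝ) (hx0 : x ≠ 0) (hx : |x| ≤ π) :
    4 * Real.sin (|x| / 2) ^ 2 * (1 / |x| ^ 2 + (|x| - |x| ^ 3 / 216) ^ 2 / (2 * π - |x|) ^ 4)
      ≤ ∑ j : Fin N, uFactorr N j x * (if (j : ℕ) = 0 then (1 : ℝ) else Sxir N x / Sxir N (x + 2 * π * (j : ℕ))) := by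
  classical
  obtain ⟨j, hj0, hj⟩ := shiftedSymbol_eq N (by omega) x hx0
  have hπ := Real.pi_pos
  set t : ℝ := |x| with ht
  have ht0 : 0 < t := abs_pos.mpr hx0
  have htπ : t ≤ π := hx
  have hN3 : (3 : ℝ) ≤ N := by exact_mod_cast hN
  have hS1 : S1r x = 4 * Real.sin (t / 2) ^ 2 := by
    rw [S1r_eq]
    rcases abs_choice x with h | h
    · rw [ht, h]
    · rw [ht, h, neg_div, Real.sin_neg, neg_sq]
  have hSx_le : Sxir N x ≤ t ^ 2 := by rw [ht, sq_abs]; exact Sxir_le N x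
  have hSx_pos : 0 < Sxir N x := Sxir_pos N (by omega) x hx0 hx
  have hSx_ge : (t - t ^ 3 / 216) ^ 2 ≤ Sxir N x := Sxir_ge_sub_cube N hN x hx
  have hθpos : 0 < (2 * π - t) / (2 * N) := by apply div_pos <;> nlinarith
  have hθlt : (2 * π - t) / (2 * N) < π := by
    rw [div_lt_iff₀ (by positivity)]; nlinarith
  have hSy_pos : 0 < Sxir N (x + 2 * π * (j : ℕ)) := by
    rw [hj]; have := Real.sin_pos_of_pos_of_lt_pi hθpos hθlt; positivity
  have hSy_le : Sxir N (x + 2 * π * (j : ℕ)) ≤ (2 * π - t) ^ 2 := by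
    rw [hj]
    have hs := Real.sin_le hθpos.le
    have hs0 := (Real.sin_pos_of_pos_of_lt_pi hθpos hθlt).le
    calc 4 * (N : ℝ) ^ 2 * Real.sin ((2 * π - t) / (2 * N)) ^ 2 = (2 * N * Real.sin ((2 * π - t) / (2 * N))) ^ 2 := by ring
      _ ≤ (2 * N * ((2 * π - t) / (2 * N))) ^ 2 :=
          pow_le_pow_left₀ (by positivity) (mul_le_mul_of_nonneg_left hs (by positivity)) 2
      _ = (2 * π - t) ^ 2 := by field_simp
  set f : Fin N → ℝ := fun j => uFactorr N j x *
    (if (j : ℕ) = 0 then (1 : ℝ) else Sxir N x / Sxir N (x + 2 * π * (j : ℕ))) with hf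
  have hf0 : ∀ i, 0 ≤ f i := fun i => letter_term_nonneg N (i : ℕ) x
  have hz : ((⟨0, by omega⟩ : Fin N) : ℕ) = 0 := rfl
  have hne : (⟨0, by omega⟩ : Fin N) ≠ j := fun h => hj0 (by rw [← h])
  have hsub : f ⟨0, by omega⟩ + f j ≤ ∑ i : Fin N, f i := by
    rw [← Finset.sum_pair hne]
    exact Finset.sum_le_sum_of_subset_of_nonneg (Finset.subset_univ _) fun i _ _ => hf0 i
  have hT0 : 4 * Real.sin (t / 2) ^ 2 * (1 / t ^ 2) ≤ f ⟨0, by omega⟩ := by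
    rw [hf]; simp only [if_true, mul_one]
    unfold uFactorr; simp only [if_true, hx0, if_false]
    rw [hS1, mul_one_div]
    exact div_le_div_of_nonneg_left (by positivity) hSx_pos hSx_le
  have hTj : 4 * Real.sin (t / 2) ^ 2 * ((t - t ^ 3 / 216) ^ 2 / (2 * π - t) ^ 4) ≤ f j := by
    rw [hf]; simp only [hj0, if_false]
    unfold uFactorr; simp only [hj0, if_false]
    rw [hS1]
    have h2πt : 0 < 2 * π - t := by linarith
    calc 4 * Real.sin (t / 2) ^ 2 * ((t - t ^ 3 / 216) ^ 2 / (2 * π - t) ^ 4)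
        = (4 * Real.sin (t / 2) ^ 2 / (2 * π - t) ^ 2) * ((t - t ^ 3 / 216) ^ 2 / (2 * π - t) ^ 2) := by
          field_simp
      _ ≤ (4 * Real.sin (t / 2) ^ 2 / Sxir N (x + 2 * π * (j : ℕ))) * (Sxir N x / Sxir N (x + 2 * π * (j : ℕ))) := by
          apply mul_le_mul
          · exact div_le_div_of_nonneg_left (by positivity) hSy_pos hSy_le
          · exact div_le_div₀ (Sxir_nonneg _ _) hSx_ge hSy_pos hSy_le
          · positivity
          · exact div_nonneg (by positivity) hSy_pos.le
  calc 4 * Real.sin (|x| / 2) ^ 2 * (1 / |x| ^ 2 + (|x| - |x| ^ 3 / 216) ^ 2 / (2 * π - |x|) ^ 4)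
      = 4 * Real.sin (t / 2) ^ 2 * (1 / t ^ 2) + 4 * Real.sin (t / 2) ^ 2 * ((t - t ^ 3 / 216) ^ 2 / (2 * π - t) ^ 4) := by
        rw [ht]; ring
    _ ≤ f ⟨0, by omega⟩ + f j := add_le_add hT0 hTj
    _ ≤ ∑ i : Fin N, f i := hsub

/-! ## §2. The one-dimensional inequality `m(t) ≥ 3∕5` on `(0, π]` -/

/-- One piece of `[2.3, 3.15]`: monotone letters and a rational certificate. [folklore] -/
theorem piece {a b t : ℝ} (ha : 23 / 10 ≤ a) (hb : b ≤ 63 / 20) (hat : a ≤ t) (htb : t ≤ b) (htπ : t ≤ π)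
    (hnum : 3 / 5 ≤ 4 * (1 - (63 / 20 - a) ^ 2 / 8) ^ 2 * (1 / b ^ 2 + (a - a ^ 3 / 216) ^ 2 / (63 / 10 - a) ^ 4)) :
    3 / 5 ≤ 4 * Real.sin (t / 2) ^ 2 * (1 / t ^ 2 + (t - t ^ 3 / 216) ^ 2 / (2 * π - t) ^ 4) := by
  have hπ1 := Real.pi_lt_d2
  have hπ2 := Real.pi_gt_d2
  have ht0 : 0 < t := by linarith
  have hσa : 0 ≤ 1 - (63 / 20 - a) ^ 2 / 8 := by nlinarith
  have hsin : 1 - (63 / 20 - a) ^ 2 / 8 ≤ Real.sin (t / 2) := by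
    have h1 : 1 - ((π - t) / 2) ^ 2 / 2 ≤ Real.cos ((π - t) / 2) := Real.one_sub_sq_div_two_le_cos
    rw [show (π - t) / 2 = π / 2 - t / 2 by ring, Real.cos_pi_div_two_sub] at h1
    have h2 : ((π / 2 - t / 2)) ^ 2 ≤ ((63 / 20 - a) / 2) ^ 2 := by
      have hlo : 0 ≤ π / 2 - t / 2 := by linarith
      exact pow_le_pow_left₀ hlo (by linarith) 2
    nlinarith
  have hsin2 : (1 - (63 / 20 - a) ^ 2 / 8) ^ 2 ≤ Real.sin (t / 2) ^ 2 := pow_le_pow_left₀ hσa hsin 2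
  have hinv : 1 / b ^ 2 ≤ 1 / t ^ 2 := by
    apply div_le_div_of_nonneg_left zero_le_one (by positivity) (pow_le_pow_left₀ ht0.le htb 2)
  have hcube : (a - a ^ 3 / 216) ^ 2 ≤ (t - t ^ 3 / 216) ^ 2 := by
    have ha0 : 0 ≤ a - a ^ 3 / 216 := by nlinarith
    have hmono : a - a ^ 3 / 216 ≤ t - t ^ 3 / 216 := by nlinarith [mul_nonneg (sub_nonneg.2 hat) (sub_nonneg.2 hat)]
    exact pow_le_pow_left₀ ha0 hmono 2
  have hden : (2 * π - t) ^ 4 ≤ (63 / 10 - a) ^ 4 := by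
    have hlo : 0 ≤ 2 * π - t := by linarith
    exact pow_le_pow_left₀ hlo (by linarith) 4
  have hden0 : 0 < (2 * π - t) ^ 4 := pow_pos (by linarith) 4
  have hfrac : (a - a ^ 3 / 216) ^ 2 / (63 / 10 - a) ^ 4 ≤ (t - t ^ 3 / 216) ^ 2 / (2 * π - t) ^ 4 :=
    div_le_div₀ (sq_nonneg _) hcube hden0 hden
  calc (3 : ℝ) / 5 ≤ 4 * (1 - (63 / 20 - a) ^ 2 / 8) ^ 2 * (1 / b ^ 2 + (a - a ^ 3 / 216) ^ 2 / (63 / 10 - a) ^ 4) := hnum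
    _ ≤ 4 * Real.sin (t / 2) ^ 2 * (1 / t ^ 2 + (t - t ^ 3 / 216) ^ 2 / (2 * π - t) ^ 4) := by
        apply mul_le_mul (mul_le_mul_of_nonneg_left hsin2 (by norm_num)) (add_le_add hinv hfrac)
          (by positivity) (by positivity)

/-- **`m(t) ≥ 3∕5` on `(0, π]`**: `(0, 2.3]` by `sin(t∕2) ≥ t∕2 − t³∕48` and the first term; `[2.3, π]` by seven `piece`s. [folklore] -/
theorem minorant_ge (t : ℝ) (ht0 : 0 < t) (htπ : t ≤ π) :
    3 / 5 ≤ 4 * Real.sin (t / 2) ^ 2 * (1 / t ^ 2 + (t - t ^ 3 / 216) ^ 2 / (2 * π - t) ^ 4) := by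
  have hπ1 := Real.pi_lt_d2
  by_cases h1 : t ≤ 23 / 10
  · -- first term only
    have hs : t / 2 - (t / 2) ^ 3 / 6 ≤ Real.sin (t / 2) := Real.sin_ge_sub_cube (by linarith)
    have hs0 : 0 ≤ t / 2 - (t / 2) ^ 3 / 6 := by nlinarith [mul_pos ht0 ht0]
    have hs2 : (t / 2 - (t / 2) ^ 3 / 6) ^ 2 ≤ Real.sin (t / 2) ^ 2 := pow_le_pow_left₀ hs0 hs 2
    have hsecond : 0 ≤ (t - t ^ 3 / 216) ^ 2 / (2 * π - t) ^ 4 := by positivity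
    have hfirst : 3 / 5 ≤ 4 * (t / 2 - (t / 2) ^ 3 / 6) ^ 2 * (1 / t ^ 2) := by
      rw [show 4 * (t / 2 - (t / 2) ^ 3 / 6) ^ 2 * (1 / t ^ 2) = (1 - t ^ 2 / 24) ^ 2 by field_simp; ring]
      have hu : (779 : ℝ) / 1000 ≤ 1 - t ^ 2 / 24 := by nlinarith [mul_pos ht0 ht0]
      have hu2 := pow_le_pow_left₀ (by norm_num) hu 2
      exact le_trans (by norm_num) hu2
    calc (3 : ℝ) / 5 ≤ 4 * (t / 2 - (t / 2) ^ 3 / 6) ^ 2 * (1 / t ^ 2) := hfirst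
      _ ≤ 4 * Real.sin (t / 2) ^ 2 * (1 / t ^ 2) := by
          apply mul_le_mul_of_nonneg_right (mul_le_mul_of_nonneg_left hs2 (by norm_num)) (by positivity)
      _ ≤ 4 * Real.sin (t / 2) ^ 2 * (1 / t ^ 2 + (t - t ^ 3 / 216) ^ 2 / (2 * π - t) ^ 4) := by
          apply mul_le_mul_of_nonneg_left (le_add_of_nonneg_right hsecond) (by positivity)
  · push Not at h1
    have htb : t ≤ 63 / 20 := by linarith
    by_cases h2 : t ≤ 24 / 10
    · exact piece (a := 23 / 10) (b := 24 / 10) (by norm_num) (by norm_num) h1.le h2 htπ (by norm_num)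
    by_cases h3 : t ≤ 25 / 10
    · exact piece (a := 24 / 10) (b := 25 / 10) (by norm_num) (by norm_num) (by linarith) h3 htπ (by norm_num)
    by_cases h4 : t ≤ 26 / 10
    · exact piece (a := 25 / 10) (b := 26 / 10) (by norm_num) (by norm_num) (by linarith) h4 htπ (by norm_num)
    by_cases h5 : t ≤ 27 / 10
    · exact piece (a := 26 / 10) (b := 27 / 10) (by norm_num) (by norm_num) (by linarith) h5 htπ (by norm_num)
    by_cases h6 : t ≤ 28 / 10
    · exact piece (a := 27 / 10) (b := 28 / 10) (by norm_num) (by norm_num) (by linarith) h6 htπ (by norm_num)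
    by_cases h7 : t ≤ 29 / 10
    · exact piece (a := 28 / 10) (b := 29 / 10) (by norm_num) (by norm_num) (by linarith) h7 htπ (by norm_num)
    · exact piece (a := 29 / 10) (b := 63 / 20) (by norm_num) (by norm_num) (by linarith) htb htπ (by norm_num)

/-! ### The side-2 leg: `g_2 ≥ 4∕5` -/

/-- The letters at side `2` in terms of `c = cos(x∕2)`: `S₁(x) = 4(1 − c²)`, `S_ξ(x) = 8(1 − c)`, `S_ξ(x + 2π) = 8(1 + c)`. [folklore] -/
theorem letters_two (x : ℝ) :
    S1r x = 4 * (1 - Real.cos (x / 2) ^ 2) ∧ Sxir 2 x = 8 * (1 - Real.cos (x / 2)) ∧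
      Sxir 2 (x + 2 * π) = 8 * (1 + Real.cos (x / 2)) := by
  refine ⟨?_, ?_, ?_⟩
  · unfold S1r
    have h := Real.cos_two_mul (x / 2)
    rw [show 2 * (x / 2) = x by ring] at h
    rw [h]; ring
  · unfold Sxir; push_cast; ring
  · unfold Sxir; push_cast
    rw [show (x + 2 * π) / (2 : ℝ) = x / 2 + π by ring, Real.cos_add_pi]; ring

/-- **`g_2(x) ≥ 4∕5` on `|x| ≤ π`**: `g_2 = (1+c)∕2 + (1−c)²∕(2(1+c))`, `c = cos(x∕2) ∈ [0,1)`, and `10c² − 8c + 2 > 0`; the sharp minimum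
`2√2 − 2` is the OWNER's (44) `OneShotChartSideTwo.pair_ge` (the same function, written with `cos²(x∕4) = (1+c)∕2`). [folklore] -/
theorem aliasSum_two_ge (x : ℝ) (hx : |x| ≤ π) :
    4 / 5 ≤ ∑ j : Fin 2, uFactorr 2 j x *
      (if (j : ℕ) = 0 then (1 : ℝ) else Sxir 2 x / Sxir 2 (x + 2 * π * (j : ℕ))) := by
  rw [Fin.sum_univ_two]
  simp only [Fin.val_zero, Fin.val_one, if_true, one_ne_zero, if_false, mul_one, Nat.cast_one]
  obtain ⟨hS1, hS0, hS1'⟩ := letters_two x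
  set c : ℝ := Real.cos (x / 2) with hc
  have hc0 : 0 ≤ c := Real.cos_nonneg_of_mem_Icc ⟨by linarith [(abs_le.mp hx).1], by linarith [(abs_le.mp hx).2]⟩
  have hc1 : c ≤ 1 := Real.cos_le_one _
  by_cases hx0 : x = 0
  · -- at `x = 0` the central factor is the removable value `1`, the other term is nonnegative
    subst hx0
    have h1 : uFactorr 2 0 0 = 1 := by unfold uFactorr; simp
    rw [h1]
    have h2 : 0 ≤ uFactorr 2 1 0 * (Sxir 2 0 / Sxir 2 (0 + 2 * π)) :=
      mul_nonneg (uFactorr_nonneg _ _ _) (div_nonneg (Sxir_nonneg _ _) (Sxir_nonneg _ _))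
    linarith
  · have hpos : 0 < Sxir 2 x := Sxir_pos 2 (by norm_num) x hx0 hx
    have hclt : c < 1 := by rw [hS0] at hpos; linarith
    have h0 : uFactorr 2 0 x = (1 + c) / 2 := by
      unfold uFactorr; simp only [if_true, hx0, if_false]; rw [hS1, hS0]
      field_simp [show (1 - c) ≠ 0 from by linarith]; ring
    have h1 : uFactorr 2 1 x = (1 - c) / 2 := by
      unfold uFactorr; simp only [one_ne_zero, if_false, Nat.cast_one, mul_one]; rw [hS1, hS1']
      field_simp; ring
    have h2 : Sxir 2 x / Sxir 2 (x + 2 * π) = (1 - c) / (1 + c) := by rw [hS0, hS1']; field_simp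
    rw [h0, h1, h2]
    have h1c : (0 : ℝ) < 1 + c := by linarith
    rw [show (1 + c) / 2 + (1 - c) / 2 * ((1 - c) / (1 + c)) = ((1 + c) ^ 2 + (1 - c) ^ 2) / (2 * (1 + c)) by
      field_simp, le_div_iff₀ (by positivity)]
    nlinarith [sq_nonneg (c - 2 / 5)]

/-! ## §3. Every block side -/

/-- **`g_N(x) ≥ 3∕5` for EVERY `N ≥ 1` and `|x| ≤ π`** (`N = 1`: `g_1 = 1`; `N = 2`: `4∕5`, `aliasSum_two_ge`;
`N ≥ 3`: the two-alias minorant and `minorant_ge`; `x = 0`: the central term is `1`). [folklore] -/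
theorem aliasSum_ge_three_fifths (N : ℕ) [NeZero N] (hN : 1 ≤ N) (x : ℝ) (hx : |x| ≤ π) :
    3 / 5 ≤ ∑ j : Fin N, uFactorr N j x * (if (j : ℕ) = 0 then (1 : ℝ) else Sxir N x / Sxir N (x + 2 * π * (j : ℕ))) := by
  classical
  have hf0 : ∀ i : Fin N, 0 ≤ uFactorr N i x *
      (if (i : ℕ) = 0 then (1 : ℝ) else Sxir N x / Sxir N (x + 2 * π * (i : ℕ))) :=
    fun i => letter_term_nonneg N (i : ℕ) x
  by_cases hx0 : x = 0
  · -- the central term alone is `1`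
    subst hx0
    have h0 : uFactorr N ((⟨0, hN⟩ : Fin N) : ℕ) 0 *
        (if (((⟨0, hN⟩ : Fin N) : ℕ)) = 0 then (1 : ℝ) else Sxir N 0 / Sxir N (0 + 2 * π * (((⟨0, hN⟩ : Fin N) : ℕ)))) = 1 := by
      simp only [if_true, mul_one]; unfold uFactorr; simp
    calc (3 : ℝ) / 5 ≤ 1 := by norm_num
      _ = _ := h0.symm
      _ ≤ _ := Finset.single_le_sum (fun i _ => hf0 i) (Finset.mem_univ _)
  rcases Nat.lt_or_ge N 3 with hlt | hge
  · interval_cases N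
    · -- `N = 1`: one alias, `S_ξ = S₁`
      rw [Fin.sum_univ_one]
      simp only [Fin.val_zero, if_true, mul_one]
      unfold uFactorr
      simp only [if_true, hx0, if_false]
      have hS : Sxir 1 x = S1r x := by unfold Sxir S1r; simp
      rw [hS, div_self (by rw [← hS]; exact (Sxir_pos 1 le_rfl x hx0 hx).ne')]
      norm_num
    · exact le_trans (by norm_num) (aliasSum_two_ge x hx)
  · exact le_trans (minorant_ge |x| (abs_pos.mpr hx0) hx) (twoAlias_le_aliasSum N hge x hx0 hx)

/-- **THE ONE-SHOT CHART LETTER, UNIFORMLY IN THE BLOCK SIDE**: `Σ_τ ‖G_{N,a,0,τ}(p)‖² ≤ N^d · (5∕3)^d · symbR(p)²` for every `N ≥ 1`,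
`a > 0`, `p ∈ [−π,π]^d` — the OWNER's (40) `sum_normSq_G_le` with `(π²∕4)^d` replaced by `(5∕3)^d`. [folklore] -/
theorem sum_normSq_G_le_uniform (N : ℕ) [NeZero N] (hN : 1 ≤ N) {a : ℝ} (ha : 0 < a) (p : Fin d → ℝ) (hp : p ∈ BZ d) :
    ∑ τ : Fin d → Fin N, ‖G N a 0 τ (ofRealVec p)‖ ^ 2 ≤ (N : ℝ) ^ d * ((5 : ℝ) / 3) ^ d * symbR N a p ^ 2 := by
  have h := sum_normSq_G_le_of_aliasSum_ge (d := d) N hN ha (c := 3 / 5) (by norm_num) (aliasSum_ge_three_fifths N hN) p hp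
  rwa [show ((3 : ℝ) / 5)⁻¹ = 5 / 3 by norm_num] at h

/-! ## §4. The `η`-norm letters, through the owner's parametric chain (43) -/

/-- **THE ONE-SHOT CHART LETTER BY VALUE, EVERY SIDE**: `((n+1)^d)⁻¹·Σ′_z (H B)(z)² ≤ (5∕3)^d·Σ′_y B(y)²` for every block
parameter `n`, every `a > 0` and every square-summable `B` — (43) `tsum_HBZd_sq_le_of_fibre` at `K := (5∕3)^d` with `sum_normSq_G_le_uniform`;
the statement of `B5HkUniformL2Zd.tsum_HBZd_sq_le_uniform` (`(c_H K_d)²`), (42) `tsum_HBZd_sq_le_uniform_sharp` (`(π²∕4)^d`), (45)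
`tsum_HBZd_sq_le_threeUp` (`0.58^{−d}`, `n ≥ 2`) with one constant and no restriction on `n`. [folklore] -/
theorem tsum_HBZd_sq_le_uniform_eta (n : ℕ) {a : ℝ} (ha : 0 < a) (Bf : X d → ℝ) (hB : Summable fun x => Bf x ^ 2) :
    (((n : ℝ) + 1) ^ d)⁻¹ * ∑' z : X d, HBZd n a Bf z ^ 2 ≤ ((5 : ℝ) / 3) ^ d * ∑' y : X d, Bf y ^ 2 := by
  rw [inv_mul_le_iff₀ (by positivity), ← mul_assoc]
  refine tsum_HBZd_sq_le_of_fibre n ha (K := ((5 : ℝ) / 3) ^ d) (by positivity) (fun p hp => ?_) Bf hB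
  have h := sum_normSq_G_le_uniform (d := d) (n + 1) (by omega) ha p hp
  push_cast at h; exact h

/-- **THE CHART CLAUSE OF (35) WITH AN EXPLICIT CONSTANT**: for a coarse field `B` supported in a finset `T`,
`((n+1)^d)⁻¹·Σ′_p (H B)(p)² ≤ (5∕3)^d·Σ_{y∈T} B(y)²` for every side `n + 1` and every `a > 0` — the last conjunct of
`FreeFieldBlockingLetters.compositeBlocking_letters` (`∃ C`, from `B5HkUniformL2Zd`) with `C := (5∕3)^d`. [folklore] -/
theorem compositeBlocking_chart_sharp (n : ℕ) {a : ℝ} (ha : 0 < a) (T : Finset (X d)) (Bf : X d → ℝ)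
    (hT : ∀ y ∉ T, Bf y = 0) :
    (((n : ℝ) + 1) ^ d)⁻¹ * ∑' p : X d, HBZd n a Bf p ^ 2 ≤ ((5 : ℝ) / 3) ^ d * ∑ y ∈ T, Bf y ^ 2 := by
  have hT2 : ∀ y ∉ T, Bf y ^ 2 = 0 := fun y hy => by rw [hT y hy]; ring
  have hB : Summable fun y => Bf y ^ 2 := summable_of_ne_finset_zero hT2
  have hs : ∑' y, Bf y ^ 2 = ∑ y ∈ T, Bf y ^ 2 := tsum_eq_sum hT2
  rw [← hs]; exact tsum_HBZd_sq_le_uniform_eta n ha Bf hB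

/-- d = 4: `(5∕3)⁴ < 7.72 < 3²` — the uniform letter is below the consumer threshold `M² = (M^{(d−2)∕2})²` for every side `M ≥ 3`
(`‖H_M‖_η < 2.78`; (42): `6.1`, (45): `2.98` for `M ≥ 3`, (44): `1.46` at `M = 2`). -/
theorem five_thirds_pow_four_lt : ((5 : ℝ) / 3) ^ 4 < 7.72 ∧ (7.72 : ℝ) < (3 : ℝ) ^ 2 := by constructor <;> norm_num

end

end Summit.QuantumFields.BalabanUV.T4Continuum.NE7b.OneShotChartFibreUniform
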